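import Summits.HodgeConjecture.HodgeConjecture.Theorems.F0P3cStCharTSWeylHypJacobianDischarge   -- ★ p851888 (this seat) (J6) FILE 1 `tubeJacobianLocal_of_orbitTube'`; brings ★ (J1) FILE 1∕2, ★ p851645
import Summits.HodgeConjecture.HodgeConjecture.Theorems.F0P3cStCharTSTubeModelTransport       -- ★ p851879 (LH6-p03 g5) (J6-T) `cm_levels`, `cm_setOf_conj_eq_smul`, `cm_measure_comap_eq`
import HarnessLib

/-!
# F0 · P3c · line LH6 «StCharTS» — ROAD «JAC-LOC» brick (J6) «ASSEMBLY → hJacLoc», FILE 2 «MODEL DOCK»: the CM-carrier socket of ★ p851645 from a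
# per-coset ORBIT-TUBE + MASS package proved on the ONE-PLACE MODEL `U(σ_w, Φ₃)(L_w)` (Harish-Chandra 1970 L. 22; Platonov–Rapinchuk §5.1)

Cell `pub/hodgecm-mathlib`, crux H413 = `stmt-HodgeConjecture-24833` (lane `--supports`, helper); seat LH6-p04 (g6); (J6) ED. 2-prep of LH6-p03 (g5)'s ROAD «JAC-LOC»
(split 2026-09-02T15:38:43Z: the MODEL LEVEL PACKAGE (J6-M) `orbit_and_mass_of_small_level` ∕ `exists_small_level_bound` is LH6-p03's; this file is the CM-side dock it
plugs into).  THEOREMS ONLY; sorry-free; no definition ∕ instance ∕ notation; axioms TRIO.  HONEST LABEL: count-neutral, closes no organ; HC_CM is proved only modulo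
the 7 printed citations (2 remaining: hLiu418 = `stmt-HodgeConjecture-24832`, h413 = `stmt-HodgeConjecture-24833`) until rung 0 closes.

WHAT.  `G = U(Φ₃)(L⁺_v)` (CM carrier of ★ p851645), `U′ = U(σ_w, Φ₃)(L_w)` the one-place model at the unique `w ∣ v`, `e : G ≃ₜ* U′` (★ `localNonsplitEquiv`), `T` the split
torus, `D : T → ℝ≥0`.  INPUT: a MODEL level basis `K′ : ℕ → Subgroup U′` (compact open, antitone, basis of `𝓝 1` — the levels `K_{γₙ}` of a schedule) and `hpkg`: at every
regular `t₀ ∈ T` an open `U ∋ t₀` with `D` constant on `U` and a threshold `n₀` such that for `n ≥ n₀` and every level coset `s·T_n ⊆ U` (`T_n = T ∩ e⁻¹K′_n`) there is a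
MODEL subgroup `P′` with the ORBIT-TUBE identity AT `e s` — `{x′ | ∃ k ∈ K′_n, ∃ τ ∈ K′_n, τ ∈ T′ ∧ k·e(s)·τ·k⁻¹ = x′} = e(s)·P′` (★-to-be (J6-M), over ★ ORBIT-TUBE-EQ
p851886) — and the MASS identity `ν′(P′) = D(s)·ν′(K′_n)` for EVERY left-invariant Borel `ν′` on `U′` (★ (J4b) `measure_sandwich_eq_vanDijk_mul_measure_level`, with
`D(s) = c(e s)·c(e s_w)` by (T4)∕★ (J7)).  OUTPUT: the `hJacLoc` clause of ★ p851645 VERBATIM.  PROOF: ★ (J6-T) `cm_levels` (compact ∕ open ∕ basis of the pull-backs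
`e⁻¹K′_n`), `Subgroup.comap_mono` (antitone), `cm_setOf_conj_eq_smul` + `cm_measure_comap_eq` (the per-coset clauses), then ★ (J6) FILE 1 `tubeJacobianLocal_of_orbitTube'`.

## References
* [HarishChandra1970] Harish-Chandra, *Harmonic analysis on reductive p-adic groups*, LNM 162 (1970), Lemma 22, Lemma 42.
* [Rogawski1990] J. D. Rogawski, *Automorphic Representations of Unitary Groups in Three Variables*, Ann. of Math. Stud. 123 (1990), §12.5 p. 182; §1.9–1.10 pp. 8–9.
* [PlatonovRapinchuk1994] V. Platonov, A. Rapinchuk, *Algebraic Groups and Number Theory* (1994), §5.1, §3.3.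
-/

set_option autoImplicit false
set_option linter.dupNamespace false

noncomputable section

open MeasureTheory Measure Set Filter Topology Function NumberField IsDedekindDomain Matrix Polynomial
open Literature.MeasureTheory.Group
open Literature.NumberTheory Literature.NumberTheory.Automorphic Literature.NumberTheory.Automorphic.UnitaryGroup Literature.NumberTheory.Rogawski1990
open Summit.HodgeConjecture.HodgeConjecture.Cruxes.H413.F0P3cStCharTSWeylHypJacobianDischarge
open Summit.HodgeConjecture.HodgeConjecture.Cruxes.H413.F0P3cStCharTSTubeModelTransport
open scoped ENNReal NNReal MatrixGroups Pointwise

namespace Summit.HodgeConjecture.HodgeConjecture.Cruxes.H413.F0P3cStCharTSWeylHypJacobianModelDock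

section CM

variable (L : Type) [Field L] [NumberField L] [IsCMField L] (v : HeightOneSpectrum (𝓞 ↥(maximalRealSubfield L)))

set_option maxHeartbeats 3200000 in
set_option synthInstance.maxHeartbeats 200000 in
-- same elaboration class as ★ p851645 ∕ ★ (J6) FILE 1 (instance terms on the CM local carrier, its quotient, and the one-place model)
/-- **(J6) «MODEL DOCK»**: the local tube-Jacobian socket `hJacLoc` of ★ p851645 on the CM carrier (its text VERBATIM) FOLLOWS from a model level basis `K′` and the
per-coset ORBIT-TUBE + MASS package `hpkg` proved on the one-place model at `e s` (module docstring).  The place `w′ ∣ v` with `c • w′ = w′` is a binder (it exists at a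
non-split `v`; `hns` gives it for every `w′`). [cite: HarishChandra1970, Lemma 22; Lemma 42] [cite: Rogawski1990, §12.5 p. 182] [cite: PlatonovRapinchuk1994, §5.1] -/
theorem tubeJacobianLocal_of_modelPackage
    (hns : ∀ w : PlacesOver L v, IsCMField.complexConj L • w.1 = w.1)
    [MeasurableSpace ↥(unitaryGroupOfForm (conjLocal L (IsCMField.complexConj L) v) (cmLocalForm L 3 v))] [BorelSpace ↥(unitaryGroupOfForm (conjLocal L (IsCMField.complexConj L) v) (cmLocalForm L 3 v))] [LocallyCompactSpace ↥(unitaryGroupOfForm (conjLocal L (IsCMField.complexConj L) v) (cmLocalForm L 3 v))] [SecondCountableTopology ↥(unitaryGroupOfForm (conjLocal L (IsCMField.complexConj L) v) (cmLocalForm L 3 v))] [T2Space ↥(unitaryGroupOfForm (conjLocal L (IsCMField.complexConj L) v) (cmLocalForm L 3 v))]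
    [MeasurableSpace (↥(unitaryGroupOfForm (conjLocal L (IsCMField.complexConj L) v) (cmLocalForm L 3 v)) ⧸ (cmBorelTriple L 3 v).M)] [BorelSpace (↥(unitaryGroupOfForm (conjLocal L (IsCMField.complexConj L) v) (cmLocalForm L 3 v)) ⧸ (cmBorelTriple L 3 v).M)]
    (ν : Measure ↥(unitaryGroupOfForm (conjLocal L (IsCMField.complexConj L) v) (cmLocalForm L 3 v))) [ν.IsHaarMeasure] [ν.IsMulRightInvariant]
    (tm : Measure ↥(cmBorelTriple L 3 v).M) [tm.IsMulLeftInvariant] [IsFiniteMeasureOnCompacts tm] [tm.IsOpenPosMeasure] [tm.IsInvInvariant]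
    (Φ : (↥(unitaryGroupOfForm (conjLocal L (IsCMField.complexConj L) v) (cmLocalForm L 3 v)) ⧸ (cmBorelTriple L 3 v).M) × ↥(cmBorelTriple L 3 v).M → ↥(unitaryGroupOfForm (conjLocal L (IsCMField.complexConj L) v) (cmLocalForm L 3 v))) (hΦ : ∀ (x : ↥(unitaryGroupOfForm (conjLocal L (IsCMField.complexConj L) v) (cmLocalForm L 3 v))) (t : ↥(cmBorelTriple L 3 v).M), Φ (QuotientGroup.mk x, t) = x * t * x⁻¹)
    (w : ↥(unitaryGroupOfForm (conjLocal L (IsCMField.complexConj L) v) (cmLocalForm L 3 v))) (hw : Units.val (w : GL (Fin 3) (LocalRing L v)) = cmLocalForm L 3 v)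
    (D : ↥(cmBorelTriple L 3 v).M → ℝ≥0)
    (w' : PlacesOver L v) (hw' : IsCMField.complexConj L • w'.1 = w'.1)
    [MeasurableSpace ↥(unitaryGroupOfForm (galAdicCompletionMap (L := L) (IsCMField.complexConj L) hw') (placeForm (Rogawski1990.qsForm L) w'.1))] [BorelSpace ↥(unitaryGroupOfForm (galAdicCompletionMap (L := L) (IsCMField.complexConj L) hw') (placeForm (Rogawski1990.qsForm L) w'.1))]
    (K' : ℕ → Subgroup ↥(unitaryGroupOfForm (galAdicCompletionMap (L := L) (IsCMField.complexConj L) hw') (placeForm (Rogawski1990.qsForm L) w'.1)))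
    (hKo' : ∀ n, IsOpen (K' n : Set ↥(unitaryGroupOfForm (galAdicCompletionMap (L := L) (IsCMField.complexConj L) hw') (placeForm (Rogawski1990.qsForm L) w'.1)))) (hKc' : ∀ n, IsCompact (K' n : Set ↥(unitaryGroupOfForm (galAdicCompletionMap (L := L) (IsCMField.complexConj L) hw') (placeForm (Rogawski1990.qsForm L) w'.1)))) (hanti' : Antitone K')
    (hbasis' : ∀ W' ∈ 𝓝 (1 : ↥(unitaryGroupOfForm (galAdicCompletionMap (L := L) (IsCMField.complexConj L) hw') (placeForm (Rogawski1990.qsForm L) w'.1))), ∃ n, (K' n : Set ↥(unitaryGroupOfForm (galAdicCompletionMap (L := L) (IsCMField.complexConj L) hw') (placeForm (Rogawski1990.qsForm L) w'.1))) ⊆ W')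
    (hpkg : ∀ t₀ : ↥(cmBorelTriple L 3 v).M, IsRegularElt (((t₀ : ↥(unitaryGroupOfForm (conjLocal L (IsCMField.complexConj L) v) (cmLocalForm L 3 v)))) : GL (Fin 3) (LocalRing L v)) →
      ∃ U : Set ↥(cmBorelTriple L 3 v).M, IsOpen U ∧ t₀ ∈ U ∧ (∀ s ∈ U, D s = D t₀) ∧ ∃ n₀ : ℕ, ∀ n, n₀ ≤ n → ∀ s : ↥(cmBorelTriple L 3 v).M,
        s • ((((((K' n).comap (localNonsplitEquiv (IsCMField.complexConj L) (Rogawski1990.qsForm L) (IsCMField.complexConj_ne_one L) w' hw').toMulEquiv.toMonoidHom : Subgroup ↥(unitaryGroupOfForm (conjLocal L (IsCMField.complexConj L) v) (cmLocalForm L 3 v)))).comap (cmBorelTriple L 3 v).M.subtype : Subgroup ↥(cmBorelTriple L 3 v).M)) : Set ↥(cmBorelTriple L 3 v).M) ⊆ U →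
          ∃ P' : Subgroup ↥(unitaryGroupOfForm (galAdicCompletionMap (L := L) (IsCMField.complexConj L) hw') (placeForm (Rogawski1990.qsForm L) w'.1)),
            {x' | ∃ k ∈ (K' n : Set ↥(unitaryGroupOfForm (galAdicCompletionMap (L := L) (IsCMField.complexConj L) hw') (placeForm (Rogawski1990.qsForm L) w'.1))), ∃ τ ∈ (K' n : Set ↥(unitaryGroupOfForm (galAdicCompletionMap (L := L) (IsCMField.complexConj L) hw') (placeForm (Rogawski1990.qsForm L) w'.1))),
                τ ∈ torusU (galAdicCompletionMap (L := L) (IsCMField.complexConj L) hw') (placeForm (Rogawski1990.qsForm L) w'.1) ∧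
                  k * (localNonsplitEquiv (IsCMField.complexConj L) (Rogawski1990.qsForm L) (IsCMField.complexConj_ne_one L) w' hw') (s : ↥(unitaryGroupOfForm (conjLocal L (IsCMField.complexConj L) v) (cmLocalForm L 3 v))) * τ * k⁻¹ = x'} =
              (localNonsplitEquiv (IsCMField.complexConj L) (Rogawski1990.qsForm L) (IsCMField.complexConj_ne_one L) w' hw') (s : ↥(unitaryGroupOfForm (conjLocal L (IsCMField.complexConj L) v) (cmLocalForm L 3 v))) • (P' : Set ↥(unitaryGroupOfForm (galAdicCompletionMap (L := L) (IsCMField.complexConj L) hw') (placeForm (Rogawski1990.qsForm L) w'.1))) ∧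
            ∀ ν' : Measure ↥(unitaryGroupOfForm (galAdicCompletionMap (L := L) (IsCMField.complexConj L) hw') (placeForm (Rogawski1990.qsForm L) w'.1)), ν'.IsMulLeftInvariant → ν' (P' : Set ↥(unitaryGroupOfForm (galAdicCompletionMap (L := L) (IsCMField.complexConj L) hw') (placeForm (Rogawski1990.qsForm L) w'.1))) = (D s : ℝ≥0∞) * ν' (K' n : Set ↥(unitaryGroupOfForm (galAdicCompletionMap (L := L) (IsCMField.complexConj L) hw') (placeForm (Rogawski1990.qsForm L) w'.1)))) :
    ∀ t₀ : ↥(cmBorelTriple L 3 v).M, IsRegularElt (((t₀ : ↥(unitaryGroupOfForm (conjLocal L (IsCMField.complexConj L) v) (cmLocalForm L 3 v)))) : GL (Fin 3) (LocalRing L v)) →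
      ∃ U : Set ↥(cmBorelTriple L 3 v).M, IsOpen U ∧ t₀ ∈ U ∧
        ∃ A₀ : Set (↥(unitaryGroupOfForm (conjLocal L (IsCMField.complexConj L) v) (cmLocalForm L 3 v)) ⧸ (cmBorelTriple L 3 v).M), MeasurableSet A₀ ∧ (quotientMeasure (cmBorelTriple L 3 v).M tm (isClosed_cmBorelTriple_M L v) ν) A₀ ≠ 0 ∧ (quotientMeasure (cmBorelTriple L 3 v).M tm (isClosed_cmBorelTriple_M L v) ν) A₀ ≠ ∞ ∧
          ∀ V : Set ↥(cmBorelTriple L 3 v).M, MeasurableSet V → V ⊆ U → (∀ t ∈ V, IsRegularElt (((t : ↥(unitaryGroupOfForm (conjLocal L (IsCMField.complexConj L) v) (cmLocalForm L 3 v)))) : GL (Fin 3) (LocalRing L v))) →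
            (∀ t ∈ V, ∀ t' ∈ V, ((t' : ↥(cmBorelTriple L 3 v).M) : ↥(unitaryGroupOfForm (conjLocal L (IsCMField.complexConj L) v) (cmLocalForm L 3 v))) ≠ w * t * w⁻¹) →
              ν (Φ '' (A₀ ×ˢ V)) = (quotientMeasure (cmBorelTriple L 3 v).M tm (isClosed_cmBorelTriple_M L v) ν) A₀ * ∫⁻ t in V, (D t : ℝ≥0∞) ∂tm := by
  -- the CM levels `e⁻¹ K′_n`: compact, open, antitone, a basis of `𝓝 1` (★ (J6-T) `cm_levels`)
  have hlev := fun n => cm_levels L v w' hw' (K' n) (hKc' n) (hKo' n) K' hbasis'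
  refine tubeJacobianLocal_of_orbitTube' L v hns ν tm Φ hΦ w hw D (fun n => ((K' n).comap (localNonsplitEquiv (IsCMField.complexConj L) (Rogawski1990.qsForm L) (IsCMField.complexConj_ne_one L) w' hw').toMulEquiv.toMonoidHom : Subgroup ↥(unitaryGroupOfForm (conjLocal L (IsCMField.complexConj L) v) (cmLocalForm L 3 v))))
    (fun n => (hlev n).1.2) (fun n => (hlev n).1.1) (fun a b hab => Subgroup.comap_mono (hanti' hab)) (hlev 0).2 fun t₀ ht₀ => ?_
  obtain ⟨U, hUo, ht₀U, hDU, n₀, hcos⟩ := hpkg t₀ ht₀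
  refine ⟨U, hUo, ht₀U, hDU, n₀, fun n hn s hsU => ?_⟩
  obtain ⟨P', hOrb', hP'⟩ := hcos n hn s hsU
  exact ⟨P'.comap (localNonsplitEquiv (IsCMField.complexConj L) (Rogawski1990.qsForm L) (IsCMField.complexConj_ne_one L) w' hw').toMulEquiv.toMonoidHom, cm_setOf_conj_eq_smul L v w' hw' (K' n) P' s hOrb',
    cm_measure_comap_eq L v w' hw' (K' n) P' (D s : ℝ≥0∞) hP' ν⟩

end CM

end Summit.HodgeConjecture.HodgeConjecture.Cruxes.H413.F0P3cStCharTSWeylHypJacobianModelDock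

end
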